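import Summits.BirchSwinnertonDyer.BirchSwinnertonDyer.Theses.SmallImageMuTransfer
import Summits.BirchSwinnertonDyer.BirchSwinnertonDyer.Theorems.KatoDescentPotSupersingularMuCoreIrrCore
import Summits.BirchSwinnertonDyer.Rank1Residual.X10.CoreTheoremAOddPrimeHolds
import Literature.NumberTheory.EllipticCurves.Kato2004.ZetaSideInputs
import HarnessLib

/-!
# The crux `MuTransfer` (stmt-BirchSwinnertonDyer-19629) BY NAME modulo the ZETA SIDE of Kato's package
# ALONE — Kato's Thm. 17.4 (Euler-system divisibility under big image) leaves the crux: the SURJECTIVE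
# branch runs through the kernel `μ`-core too

Cell `bsd-smallim` (rung K6 of `BirchSwinnertonDyer`, class X9), seat `bsd-line-k6-p2` gen 2 (D-0154 KEY (146)
row 9; line `f1_fine` of `Cruxes/MuTransfer`).  HONEST FRAMING: proves no case of BSD and closes no item —
19629 stays OPEN by design; the deciding theorems here are CONDITIONAL on ONE named published fact (the gate records
`conditional-result`).  PARTITION (D-0054): X9 (A4) and the surjective good-ordinary rows — types-the-object-of;
closes NONE; bears_on: K6 (route-BirchSwinnertonDyer-SmallImageMuTransfer item 19629; shared with route PrintX9).

## What is new

Of record: `Theorems.smallImageMuTransfer_MuTransfer_of_fine : F1 → MuTransfer` (k6-c2 g6, p482919) and, since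
gen 0 of this seat, `Theorems.smallImageMuTransfer_MuTransfer_of_zetaSide_of_kato : ZS → (∀ data, kato_divisibility)
→ MuTransfer` (p608109): the NON-surjective branch needs only the zeta side ZS = `Kato2004.exists_zetaSideInputs`
(zeta-element construction, Thm. 12.6 + Ex. 13.3 span, Thm. 16.6 (2) + 17.5 read at `(p)`, Prop. 17.11 injectivity,
(17.13.1) exactness at `P`, the fine quotient (14.9.3)), the SURJECTIVE branch was keyed to Kato's Thm. 17.4
(`kato_divisibility`, i.e. Thm. 12.4, 12.5 (4), 13.4 under the big-image hypothesis).

THIS FILE removes Thm. 17.4: **`smallImageMuTransfer_MuTransfer_of_zetaSide : ZS → MuTransfer`**.  The surjective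
branch is run through the SAME kernel `μ`-core as the non-surjective one.  That core (cell `bsd-smallim`'s
Theorem A, MU-TRANSFER-PROOF §§1–5; kernel assembly `CoreAssembly.coreOdd_…`, cells `bsd-smallim`/`b2b-bsdres`)
consumed the binder `¬ Surj` only through two IMAGE FACTS, as typed by cell `bsd-potss` (seat k9-c4 g14,
`Theorems/KatoDescentPotSupersingularMuCoreIrr*.lean`, whose `CoreAssembly.coreIrr_anyReduction_holds` is
UNCONDITIONAL under them):

* (SC) some `z ∈ Γ_ℚ` acts on `E[p]` as a scalar `a ≠ 1`;
* (IF) no normal subgroup of `Γ_ℚ` containing `ker ρ̄_{E,p}` has index `p` (whence `ℚ(E[p]) ∩ ℚ_∞ = ℚ`).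

Both hold for a SURJECTIVE `ρ̄_{E,p}` at every odd `p` (§§1–2, new here): (SC) with `z ↦ −1`; (IF) because
**`GL₂(𝔽_p)`, `p` odd, has no normal subgroup of index `p`** (§1, `GL2OddIndex.not_normal_index_eq`: the
quotient is cyclic of order `p`; every transvection `u` satisfies `u·u·d = d·u` with `d = diag(2,1)` resp.
`diag(1,2)`, so `ū² = ū`, `ū = 1`; `diag(1,δ)` has order dividing `p − 1`, coprime to `p`; and
`g = u₁₂((a−1)/c)·u₂₁(c)·u₁₂((d/δ−1)/c)·diag(1,δ)` for `c ≠ 0`, the case `c = 0` being moved to `c ≠ 0` by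
`u₂₁(1)`).  For `ρ̄` NOT onto both are tree theorems (Serre Prop. 15: `p ∤ #Ḡ`;
`LevelE.exists_galoisRepTorsion_eq_smul_of_ne_two`).  Hence (§3) **`μ(X(E/ℚ_∞)) = 0` at every ODD good
ordinary prime with `E[p]` irreducible — ANY image, CM or not — from ZS and one unit coefficient of `L_p(f,α)`**
(`smallImageMuTransfer_mu_eq_zero_of_irr_of_zetaSide`; the bookkeeping over ZS is gen 0's, verbatim), and (§4)
the parent item BY NAME from ZS alone.  Since F1 ⟹ ZS (`Kato2004.exists_zetaSideInputs_of_fineQuotient_zeta`),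
the registered stub `stub_inputs : F1` of line `f1_fine` still closes the crux through this door; what changed is
the published-input surface: Kato's Thm. 12.4, 12.5 (2)–(4), 13.4, 17.4 and (17.13.2)/(17.13.4) are now out of
the cone of the WHOLE crux, not only of its non-surjective branch.  For the planner (not this seat's call): the
single stub may be re-keyed `stub_zetaSide : Kato2004.exists_zetaSideInputs` with composition this file.

References: K. Kato, Astérisque 295 (2004) Thm. 12.5 (1), 12.6, Ex. 13.3, §13.8, (14.9.3), Thm. 16.6 (2), 17.5,
Prop. 17.11, §17.13 [Kato2004Asterisque]; R. Greenberg, V. Vatsal, Invent. Math. 142 (2000) Prop. 3.7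
[GreenbergVatsal2000]; J.-P. Serre, Invent. Math. 15 (1972) §2.4 Prop. 15, §2.5–2.6 [Serre1972]; L. E. Dickson,
*Linear groups* (1901) Ch. XII (subgroups of `PSL₂(q)`; here only the elementary `p` odd ⟹ no index-`p` normal
subgroup of `GL₂(𝔽_p)`) [folklore]; HOME/koly/MU-TRANSFER-PROOF.md Theorem A.
-/

-- the summit and its single problem are both named `BirchSwinnertonDyer` (registry layout D-0017)
set_option linter.dupNamespace false
set_option autoImplicit false

noncomputable section

open scoped Classical MatrixGroups ModularForm NumberField
open CongruenceSubgroup WeierstrassCurve Field IsDedekindDomain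
open Literature.NumberTheory.GaloisRepresentations
open Literature.NumberTheory.EllipticCurves Literature.NumberTheory.EllipticCurves.ModularForms
open Literature.NumberTheory.EllipticCurves.Kato2004
open Literature.NumberTheory.EllipticCurves.Kato2004.EulerSystemValues
open Literature.NumberTheory.EllipticCurves.Rank1Residual
open Summit.BirchSwinnertonDyer.BirchSwinnertonDyer.Rank1Residual
open Summit.BirchSwinnertonDyer.BirchSwinnertonDyer.Theses.SmallImageMuTransfer

namespace Summit.BirchSwinnertonDyer.BirchSwinnertonDyer.Theorems

/-! ## §1 Group theory: `GL₂(𝔽_p)`, `p` odd, has no normal subgroup of index `p` -/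

namespace GL2OddIndex

open Matrix Matrix.GeneralLinearGroup

variable {p : ℕ} [Fact p.Prime]

/-- **For an odd prime `p`, `GL₂(𝔽_p)` has no normal subgroup of index `p`.**  The quotient by such an `N`
is cyclic of prime order, hence commutative; (a) an element killed by `p − 1` lies in `N` (`gcd(p−1,p) = 1`);
(b) if `u·u·d = d·u` then `ū² ū̸… = ū`, so `u ∈ N` — applied to the transvections `u₁₂(c)` with `d = diag(2,1)`
and `u₂₁(c)` with `d = diag(1,2)` (`2 ≠ 0`); (c) `diag(1,δ) ∈ N` by (a); (d) every `g` with lower-left entry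
`c ≠ 0` is `u₁₂((a−1)/c)·u₂₁(c)·u₁₂((d/δ−1)/c)·diag(1,δ)`, and `u₂₁(1)·g` has lower-left entry `a ≠ 0` when
`c = 0`.  So `N = ⊤`, of index `1 ≠ p`.  (Elementary; cf. Dickson / Serre 1972 §2.4 for the subgroup structure of
`GL₂(𝔽_p)`.) [folklore] -/
theorem not_normal_index_eq (hp2 : p ≠ 2) (N : Subgroup (GL (Fin 2) (ZMod p)))
    [hN : N.Normal] (hidx : N.index = p) : False := by
  classical
  have hp := (Fact.out : p.Prime)
  -- the quotient has prime order: cyclic, hence commutative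
  have hcard : Nat.card (GL (Fin 2) (ZMod p) ⧸ N) = p := by rw [← Subgroup.index_eq_card, hidx]
  haveI : IsCyclic (GL (Fin 2) (ZMod p) ⧸ N) := isCyclic_of_prime_card hcard
  set φ : GL (Fin 2) (ZMod p) →* GL (Fin 2) (ZMod p) ⧸ N := QuotientGroup.mk' N with hφ
  have hcomm : ∀ x y : GL (Fin 2) (ZMod p) ⧸ N, x * y = y * x := fun x y =>
    IsMulCommutative.is_comm.comm x y
  have hmem : ∀ g : GL (Fin 2) (ZMod p), g ∈ N ↔ φ g = 1 := fun g => by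
    rw [hφ, QuotientGroup.mk'_apply, QuotientGroup.eq_one_iff]
  -- (a) an element killed by `p - 1` lies in `N`
  have hpow : ∀ g : GL (Fin 2) (ZMod p), g ^ (p - 1) = 1 → g ∈ N := by
    intro g hg
    rw [hmem]
    have h1 : φ g ^ (p - 1) = 1 := by rw [← map_pow, hg, map_one]
    have h2 : φ g ^ p = 1 := by
      have h := pow_card_eq_one' (G := GL (Fin 2) (ZMod p) ⧸ N) (x := φ g)
      rwa [hcard] at h
    have hcop : (p - 1).gcd p = 1 :=
      ((Nat.coprime_self_sub_left hp.one_lt.le).mpr (Nat.coprime_one_left p))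
    have h3 : φ g ^ ((p - 1).gcd p) = 1 := pow_gcd_eq_one.mpr ⟨h1, h2⟩
    rwa [hcop, pow_one] at h3
  -- (b) absorption: `u * u * d = d * u` forces `u ∈ N`
  have habs : ∀ u d : GL (Fin 2) (ZMod p), u * u * d = d * u → u ∈ N := by
    intro u d h
    rw [hmem]
    have h' : φ u * φ u * φ d = φ d * φ u := by rw [← map_mul, ← map_mul, h, map_mul]
    rw [hcomm (φ d) (φ u)] at h'
    exact mul_eq_right.mp (mul_right_cancel h')
  -- `2 ≠ 0` in `𝔽_p` (`p` odd; cf. `BinaryQuartic.two_ne_zero_zmod`)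
  have h2 : (2 : ZMod p) ≠ 0 := by
    intro h
    have h' : ((2 : ℕ) : ZMod p) = 0 := by exact_mod_cast h
    have hdvd : p ∣ 2 := (ZMod.natCast_eq_zero_iff 2 p).mp h'
    have hle : p ≤ 2 := Nat.le_of_dvd two_pos hdvd
    have h2' : 2 ≤ p := hp.two_le
    omega
  -- upper and lower transvections lie in `N`
  have hU : ∀ c : ZMod p,
      mkOfDetNeZero !![1, c; 0, 1] (by simp [Matrix.det_fin_two_of]) ∈ N := by
    intro c
    refine habs _ (mkOfDetNeZero !![2, 0; 0, 1] (by simp [Matrix.det_fin_two_of, h2])) ?_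
    refine Matrix.GeneralLinearGroup.ext fun i j => ?_
    simp only [coe_mul, val_mkOfDetNeZero, Matrix.mul_fin_two]
    fin_cases i <;> fin_cases j <;> simp
    ring
  have hL : ∀ c : ZMod p,
      mkOfDetNeZero !![1, 0; c, 1] (by simp [Matrix.det_fin_two_of]) ∈ N := by
    intro c
    refine habs _ (mkOfDetNeZero !![1, 0; 0, 2] (by simp [Matrix.det_fin_two_of, h2])) ?_
    refine Matrix.GeneralLinearGroup.ext fun i j => ?_
    simp only [coe_mul, val_mkOfDetNeZero, Matrix.mul_fin_two]
    fin_cases i <;> fin_cases j <;> simp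
    ring
  -- (c) the diagonal units `diag(1, δ)` lie in `N`
  have hD : ∀ (δ : ZMod p) (hδ : δ ≠ 0),
      mkOfDetNeZero !![1, 0; 0, δ] (by simp [Matrix.det_fin_two_of, hδ]) ∈ N := by
    intro δ hδ
    refine hpow _ ?_
    refine Matrix.GeneralLinearGroup.ext fun i j => ?_
    have hdiag : (!![1, 0; 0, δ] : Matrix (Fin 2) (Fin 2) (ZMod p)) = Matrix.diagonal ![1, δ] := by
      ext i j; fin_cases i <;> fin_cases j <;> simp
    rw [Units.val_pow_eq_pow_val, val_mkOfDetNeZero, hdiag, Matrix.diagonal_pow]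
    have hv : (![(1 : ZMod p), δ]) ^ (p - 1) = ![1, 1] := by
      ext k; fin_cases k <;> simp [ZMod.pow_card_sub_one_eq_one hδ]
    rw [hv]
    fin_cases i <;> fin_cases j <;> simp
  -- (d) every element lies in `N`
  have hall : ∀ g : GL (Fin 2) (ZMod p), g ∈ N := by
    -- elements with nonzero lower-left entry
    have hc : ∀ g : GL (Fin 2) (ZMod p), (g : Matrix (Fin 2) (Fin 2) (ZMod p)) 1 0 ≠ 0 → g ∈ N := by
      intro g hc
      set a := (g : Matrix (Fin 2) (Fin 2) (ZMod p)) 0 0 with ha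
      set b := (g : Matrix (Fin 2) (Fin 2) (ZMod p)) 0 1 with hb
      set c := (g : Matrix (Fin 2) (Fin 2) (ZMod p)) 1 0 with hc'
      set d := (g : Matrix (Fin 2) (Fin 2) (ZMod p)) 1 1 with hd
      set δ := a * d - b * c with hδ'
      have hdet : Matrix.det (g : Matrix (Fin 2) (Fin 2) (ZMod p)) = δ := by
        rw [Matrix.det_fin_two]
      have hδ : δ ≠ 0 := by
        rw [← hdet]
        exact Matrix.GeneralLinearGroup.det_ne_zero g
      have key : g = mkOfDetNeZero !![1, (a - 1) / c; 0, 1] (by simp [Matrix.det_fin_two_of]) *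
          mkOfDetNeZero !![1, 0; c, 1] (by simp [Matrix.det_fin_two_of]) *
          mkOfDetNeZero !![1, (d / δ - 1) / c; 0, 1] (by simp [Matrix.det_fin_two_of]) *
          mkOfDetNeZero !![1, 0; 0, δ] (by simp [Matrix.det_fin_two_of, hδ]) := by
        refine Matrix.GeneralLinearGroup.ext fun i j => ?_
        simp only [coe_mul, val_mkOfDetNeZero, Matrix.mul_fin_two]
        fin_cases i <;> fin_cases j
        · simp [← ha]; field_simp; ring
        · simp [← hb]; field_simp; rw [hδ']; ring
        · simp [← hc']
        · simp [← hd]; field_simp; ring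
      rw [key]
      exact N.mul_mem (N.mul_mem (N.mul_mem (hU _) (hL _)) (hU _)) (hD δ hδ)
    intro g
    by_cases hg : (g : Matrix (Fin 2) (Fin 2) (ZMod p)) 1 0 = 0
    · -- multiply by the lower transvection `u₂₁(1) ∈ N`
      have hLg : (mkOfDetNeZero !![1, 0; 1, 1] (by simp [Matrix.det_fin_two_of]) * g) ∈ N := by
        refine hc _ ?_
        have ha0 : (g : Matrix (Fin 2) (Fin 2) (ZMod p)) 0 0 ≠ 0 := by
          intro h0
          apply Matrix.GeneralLinearGroup.det_ne_zero g
          rw [Matrix.det_fin_two, h0, hg]; ring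
        simp only [coe_mul, val_mkOfDetNeZero]
        rw [Matrix.eta_fin_two (g : Matrix (Fin 2) (Fin 2) (ZMod p)), Matrix.mul_fin_two]
        simpa [hg] using ha0
      have := N.mul_mem (N.inv_mem (hL 1)) hLg
      simpa using this
    · exact hc g hg
  -- hence `N = ⊤`, of index `1 ≠ p`
  have htop : N = ⊤ := (Subgroup.eq_top_iff' N).mpr hall
  rw [htop, Subgroup.index_top] at hidx
  exact hp.one_lt.ne' hidx.symm

/-- **Transported form**: a group isomorphic to `GL₂(𝔽_p)`, `p` odd, has no normal subgroup of index `p`.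
[folklore] -/
theorem not_normal_index_eq_of_mulEquiv (hp2 : p ≠ 2) {A : Type*} [Group A]
    (Φ : A ≃* GL (Fin 2) (ZMod p)) (N : Subgroup A) [hN : N.Normal] (hidx : N.index = p) : False := by
  haveI : (N.map Φ.toMonoidHom).Normal := hN.map Φ.toMonoidHom Φ.surjective
  refine not_normal_index_eq hp2 (N.map Φ.toMonoidHom) ?_
  rw [Subgroup.index_map_eq _ Φ.surjective ?_, hidx]
  intro x hx
  have hx1 : x = 1 := Φ.injective (by simpa using hx)
  rw [hx1]
  exact N.one_mem

end GL2OddIndex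

/-! ## §2 The image facts (SC)/(IF) for a surjective `ρ̄_{E,p}` and for every irreducible `E[p]`, `p` odd -/

section ImageFacts

variable (W : WeierstrassCurve ℚ) [W.IsElliptic] (p : ℕ) [Fact p.Prime]

/-- **(IF) for `ρ̄_{E,p}` ONTO, `p` odd**: no normal subgroup of `Γ_ℚ` containing `ker ρ̄_{E,p}` has index `p`
(`ℚ(E[p])` contains no cyclic degree-`p` subfield): push `N` forward along `ρ̄_{E,p} : Γ_ℚ ↠ Aut(E[p])` and a
frame `Aut(E[p]) ≃ GL₂(𝔽_p)` (`exists_frame_galoisRepTorsion_rat`); the index is preserved and §1 applies.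
[cite: Serre1972, §2.4 Prop. 15, §2.5–2.6] -/
theorem forall_normal_index_ne_of_hasSurjectiveModNGaloisRep (hp2 : p ≠ 2)
    (hs : W.HasSurjectiveModNGaloisRep p) :
    ∀ N : Subgroup (absoluteGaloisGroup ℚ), N.Normal →
      (galoisRepTorsion W (p : ℕ)).ker ≤ N → N.index ≠ p := by
  intro N hN hle hidx
  obtain ⟨-, Φ, -⟩ := exists_frame_galoisRepTorsion_rat W p
  have hs' : Function.Surjective (galoisRepTorsion W (p : ℕ)) := hs
  haveI : (N.map (galoisRepTorsion W (p : ℕ))).Normal := hN.map _ hs'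
  refine GL2OddIndex.not_normal_index_eq_of_mulEquiv hp2 Φ (N.map (galoisRepTorsion W (p : ℕ))) ?_
  rw [Subgroup.index_map_eq _ hs' hle, hidx]

/-- **(IF) for EVERY `E/ℚ` with `E[p]` irreducible, `p` odd** (onto: the previous theorem; not onto:
`p ∤ #Ḡ = [Γ_ℚ : ker ρ̄]` by Serre's Prop. 15, tree theorem
`not_dvd_card_range_galoisRepTorsion_of_irreducible_of_not_surjective`, while `[Γ_ℚ : N] ∣ [Γ_ℚ : ker ρ̄]`).
[cite: Serre1972, §2.4 Prop. 15, §2.5–2.6] -/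
theorem forall_normal_index_ne_of_irreducible_of_ne_two (hp2 : p ≠ 2)
    (hirr : W.HasIrreducibleModPGaloisRep p) :
    ∀ N : Subgroup (absoluteGaloisGroup ℚ), N.Normal →
      (galoisRepTorsion W (p : ℕ)).ker ≤ N → N.index ≠ p := by
  intro N hN hle hidx
  by_cases hs : W.HasSurjectiveModNGaloisRep p
  · exact forall_normal_index_ne_of_hasSurjectiveModNGaloisRep W p hp2 hs N hN hle hidx
  · have hG := not_dvd_card_range_galoisRepTorsion_of_irreducible_of_not_surjective W p hirr hs
    have hdvd : N.index ∣ (galoisRepTorsion W (p : ℕ)).ker.index := Subgroup.index_dvd_of_le hle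
    rw [hidx, Subgroup.index_ker] at hdvd
    exact hG hdvd

omit [W.IsElliptic] in
/-- **(SC) for `ρ̄_{E,p}` ONTO, `p` odd**: some `z ∈ Γ_ℚ` acts on `E[p]` as the scalar `p − 1 = −1 ≠ 1`
(the preimage of `−1 ∈ Aut(E[p])`). [cite: Serre1972, §2.5–2.6] -/
theorem exists_smul_eq_val_smul_of_hasSurjectiveModNGaloisRep (hp2 : p ≠ 2)
    (hs : W.HasSurjectiveModNGaloisRep p) :
    ∃ (z : absoluteGaloisGroup ℚ) (a : ZMod p), a ≠ 1 ∧
      ∀ P : geomTorsion W (p : ℤ), z • P = a.val • P := by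
  have hp := (Fact.out : p.Prime)
  obtain ⟨z, hz⟩ := hs (Multiplicative.ofAdd (AddEquiv.neg (geomTorsion W (p : ℤ))))
  have hval : ((p - 1 : ℕ) : ZMod p).val = p - 1 := ZMod.val_cast_of_lt (Nat.sub_lt hp.pos one_pos)
  refine ⟨z, ((p - 1 : ℕ) : ZMod p), ?_, fun P => ?_⟩
  · intro h
    haveI : Fact (1 < p) := ⟨hp.one_lt⟩
    have h1 : ((p - 1 : ℕ) : ZMod p).val = 1 := by rw [h, ZMod.val_one]
    rw [hval] at h1
    have h2 : 2 ≤ p := hp.two_le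
    omega
  · have hneg : z • P = -P := by
      rw [← W.galoisRepTorsion_apply (p : ℤ) z P, hz]
      rfl
    have hpP : p • P = 0 := AddSubgroup.torsionBy.nsmul P
    rw [hneg, hval, eq_comm, ← sub_eq_zero, sub_neg_eq_add, ← succ_nsmul,
      Nat.sub_add_cancel hp.one_lt.le]
    exact hpP

/-- **(SC) for EVERY `E/ℚ` with `E[p]` irreducible, `p` odd** (onto: the previous theorem; not onto: the
tree's scalar lemma `LevelE.exists_galoisRepTorsion_eq_smul_of_ne_two`, Serre Prop. 15 / §2.6, `a = −1` at
`p = 3`). [cite: Serre1972, §2.4 Prop. 15 and §2.6] -/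
theorem exists_smul_eq_val_smul_of_irreducible_of_ne_two (hp2 : p ≠ 2)
    (hirr : W.HasIrreducibleModPGaloisRep p) :
    ∃ (z : absoluteGaloisGroup ℚ) (a : ZMod p), a ≠ 1 ∧
      ∀ P : geomTorsion W (p : ℤ), z • P = a.val • P := by
  by_cases hs : W.HasSurjectiveModNGaloisRep p
  · exact exists_smul_eq_val_smul_of_hasSurjectiveModNGaloisRep W p hp2 hs
  · obtain ⟨σ, a, ha, hσ⟩ := LevelE.exists_galoisRepTorsion_eq_smul_of_ne_two W p hp2 hirr hs
    exact ⟨σ, a, ha, fun P => by rw [← W.galoisRepTorsion_apply (p : ℤ) σ P]; exact hσ P⟩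

end ImageFacts

/-! ## §3 `μ = 0` at every odd good ordinary prime with `E[p]` irreducible — ANY image — from ZS -/

/-- **`μ(X(E/ℚ_∞)) = 0` at every ODD good ordinary prime with `E[p]` irreducible — `ρ̄_{E,p}` onto or not, CM
or not — given one unit coefficient of `L_p(f, α)`, modulo the ZETA SIDE of Kato's package ALONE** (ZS =
`Kato2004.exists_zetaSideInputs`).  Gen 0's bookkeeping verbatim (`smallImageMuTransfer_mu_eq_zero_of_nonsurj_of_zetaSide`,
p608109) with the core taken from cell `bsd-potss`' image-facts form
`CoreAssembly.coreIrr_anyReduction_holds` (unconditional) fed by §2: GV Prop. 3.7 gives `ι G₁ = L_p` and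
`G₁ ∉ (p)`; the `(p)`-clause and the span clause of ZS give a GENUINE Euler-system class outside `p𝐇¹`
(`ZetaSideInputs.exists_isEulerSystemClass_notMem`); the core kills `Sel₀(ℚ_∞, E[p^∞])[p]` by a power of `T`,
so `length_(p) X₀ = 0`; exactness at `P`, the injective Coleman map and the fine quotient give `D.mu = 0`
(`ZetaSideInputs.mu_eq_zero_of_lengthAt_fine_eq_zero`).  Conditional on ZS only; nothing asserted.
[cite: Kato2004Asterisque, Thm. 12.6 (p. 222), Ex. 13.3 (p. 225), §13.8 (pp. 228–229), (14.9.3) (p. 240), Thm. 16.6 (2) (p. 271), Prop. 17.11 (p. 277) and §17.13 (pp. 279–280)]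
[cite: GreenbergVatsal2000, Prop. 3.7] [cite: Serre1972, §2.4 Prop. 15, §2.5–2.6] -/
theorem smallImageMuTransfer_mu_eq_zero_of_irr_of_zetaSide (hZS : exists_zetaSideInputs) :
    ∀ (W : WeierstrassCurve ℚ) [W.IsElliptic] [W.IsGloballyMinimal] (p : ℕ) [Fact p.Prime]
      {N : ℕ} [NeZero N] (f : CuspForm (Gamma0 N) 2),
      p ≠ 2 → W.HasGoodReductionAtPrime p → ¬ (p : ℤ) ∣ W.frobeniusTrace p →
      W.HasIrreducibleModPGaloisRep p → IsNewformOf W f →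
      (∃ n : ℕ, ‖PowerSeries.coeff n (padicLFunction f (unitRoot W p : ℚ_[p]))‖ = 1) →
      ∀ (κ : ZpExtension ℚ p) (γ : absoluteGaloisGroup ℚ),
        κ.IsCyclotomic → κ.IsTopGenerator γ → IsCyclotomicVariable p γ →
        ∀ D : W.SelmerDualData κ γ, D.mu = 0 := by
  intro W _ _ p _ N _ f hp2 hgood hap hirr hf hcert κ γ hκ hγ hγ' D
  haveI : ContinuousSMul ℤ_[p] (W.tateModule p) := TateModule.continuousSMul_padicInt
  haveI : Module.Free ℤ_[p] (W.tateModule p) := W.module_free_tateModule_holds p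
  haveI : Module.Finite ℤ_[p] (W.tateModule p) := W.module_finite_tateModule_holds p
  have hord : IsOrdinaryAt W p := ⟨hgood, hap⟩
  -- the image facts (SC)/(IF), onto or not (§2)
  have hSC := exists_smul_eq_val_smul_of_irreducible_of_ne_two W p hp2 hirr
  have hIF := forall_normal_index_ne_of_irreducible_of_ne_two W p hp2 hirr
  -- the pinned modules: `𝐇¹_Γ(T_pW)` and the dual fine Selmer group `X₀(E/ℚ_∞)`
  obtain ⟨I⟩ := nonempty_iwasawaH1Data_holds W p κ γ hκ hγ
  obtain ⟨Y⟩ := W.nonempty_fineSelmerDualData κ hγ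
  -- `X(E/ℚ_∞)` is finitely generated over `Λ` for the cyclotomic `κ` (tree theorem)
  haveI : Module.Finite (IwasawaAlgebra p) D.X :=
    WeierstrassCurve.SelmerDualData.module_finite_of_isCyclotomic W κ hκ D hγ
  -- the zeta-side package
  obtain ⟨K⟩ := hZS W p f κ γ hp2 hord hκ hγ hγ' hf I D Y
  haveI : Module.Finite (IwasawaAlgebra p) Y.X := Module.Finite.of_surjective K.π K.π_surjective
  -- `L_p ∈ Λ` (GV Prop. 3.7) and the certificate: `G₁ ∉ (p)`
  obtain ⟨G₁, hG₁⟩ := exists_iwasawaToPowerSeries_eq_padicLFunction hp2 hord hf hirr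
  have hμL : G₁ ∉ IwasawaAlgebra.augIdealP p := not_mem_augIdealP_of_norm_coeff_eq_one hG₁ hcert
  -- §6 (i) with the span clause: some GENUINE Euler-system class is not divisible by `p`
  obtain ⟨s, hs, hsp⟩ := K.exists_isEulerSystemClass_notMem hirr hG₁ hμL
  -- the core under image facts (cell bsd-potss, unconditional, any reduction, odd prime)
  obtain ⟨J, hJ⟩ := CoreAssembly.coreIrr_anyReduction_holds W p κ γ I hp2 hirr hSC hIF hκ hγ ⟨s, hs, hsp⟩
  haveI : Finite (Y.X ⧸ (IwasawaAlgebra.augIdealP p • (⊤ : Submodule (IwasawaAlgebra p) Y.X))) :=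
    Y.finite_quotient_augIdealP_of_finite_pTorsion
      (W.finite_fineSelmerInfty_pTorsion_of_forall_iterate_eq_zero κ hγ hJ)
  -- bookkeeping at `𝔭 = (p)`: `length X₀_𝔭 = 0 ⟹ μ(X) = 0`
  let 𝔭 : PrimeSpectrum (IwasawaAlgebra p) :=
    ⟨IwasawaAlgebra.augIdealP p, IwasawaAlgebra.isPrime_augIdealP_holds p⟩
  have hY0 : Module.lengthAt (IwasawaAlgebra p) Y.X 𝔭 = 0 :=
    Summit.BirchSwinnertonDyer.BirchSwinnertonDyer.Rank1Residual.KatoMuSkeleton.lengthAt_eq_zero_of_finite_quotient_p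
      (M := Y.X) 𝔭 rfl
  exact K.mu_eq_zero_of_lengthAt_fine_eq_zero hirr hG₁ hcert 𝔭 rfl hY0

/-! ## §4 The parent item by name, modulo the zeta side ALONE -/

/-- **The parent crux `MuTransfer` (stmt-BirchSwinnertonDyer-19629), literally the route decl, modulo the ZETA SIDE
of Kato's package ALONE** (ZS = `Kato2004.exists_zetaSideInputs`: the zeta-element construction with Thm. 12.6 +
Ex. 13.3, Thm. 16.6 (2) + 17.5 read at `(p)`, Prop. 17.11, (17.13.1) at `P`, (14.9.3)).  No excluded middle on
`surj(p)` any more: `smallImageMuTransfer_mu_eq_zero_of_irr_of_zetaSide` at `5 ≤ p`.  The hypothesis is IMPLIED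
by F1 (`Kato2004.exists_zetaSideInputs_of_fineQuotient_zeta`) and is one conjunct of p608109's; Kato's Thm. 12.4,
12.5 (2)–(4), 13.4, 17.4, (17.13.2), (17.13.4) are out of the cone of the crux.  Conditional; the item stays open
until ZS (or F1) is a theorem; BSD not advanced.
[cite: Kato2004Asterisque, Thm. 12.6 (p. 222), Thm. 16.6 (2) (p. 271), Prop. 17.11 (p. 277) and §17.13 (pp. 279–280)]
[cite: GreenbergVatsal2000, Prop. 3.7] -/
theorem smallImageMuTransfer_MuTransfer_of_zetaSide (hZS : exists_zetaSideInputs) :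
    Summit.BirchSwinnertonDyer.BirchSwinnertonDyer.Theses.SmallImageMuTransfer.MuTransfer := by
  unfold Summit.BirchSwinnertonDyer.BirchSwinnertonDyer.Theses.SmallImageMuTransfer.MuTransfer
    Summit.BirchSwinnertonDyer.BirchSwinnertonDyer.Rank1Residual.KatoMuTransfer
  intro W _ _ p _ N _ f hp hgood hap hirr hf hcert κ γ hκ hγ hγ' D
  exact smallImageMuTransfer_mu_eq_zero_of_irr_of_zetaSide hZS W p f (by omega) hgood hap hirr hf hcert κ γ
    hκ hγ hγ' D

/-- **The same statement under the tree's name `Rank1Residual.KatoMuTransfer`** (head constant of item 19629 and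
of `Theses.PrintX9.MuTransfer`), modulo ZS alone.
[cite: Kato2004Asterisque, Thm. 12.6 (p. 222), Thm. 16.6 (2) (p. 271) and §17.13 (pp. 279–280)] -/
theorem smallImageMuTransfer_katoMuTransfer_of_zetaSide (hZS : exists_zetaSideInputs) :
    Summit.BirchSwinnertonDyer.BirchSwinnertonDyer.Rank1Residual.KatoMuTransfer :=
  smallImageMuTransfer_MuTransfer_of_zetaSide hZS

end Summit.BirchSwinnertonDyer.BirchSwinnertonDyer.Theorems

end
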